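import Mathlib.LinearAlgebra.BilinearForm.Orthogonal
import Summits.HodgeConjecture.HodgeConjecture.Theorems.LinearSystemTorelliLocalTubeSpanAbelianTail

/-!
# Route LinearSystemTorelli — crux `LocalTubeSpan`: several orthogonal clusters — the tail

Helper file (`--supports stmt-HodgeConjecture-2490`, line `Sketch`, first half of stub `stub_multiCluster`).
General MULTI-BRANCH point of the discriminant: the local monodromy group `G` is generated by the
meridians `s j` of finitely many Janssen-complete clusters (`j : Fin b`; distinct clusters have
ORTHOGONAL cycles — several singular points, or several branches glued only through radicals) and
node meridians `s₀` (non-zero cycles orthogonal to everything), all acting by Picard–Lefschetz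
transvections `t(x) = x - B(x, e_t) e_t` of the nondegenerate alternating intersection form `B` on
`V = H^{2p-1}(X_s, ℚ)_van`.  The frame mechanism gives, cluster by cluster, a vector `v_j` with
`φ(t) = t·v_j - v_j` on `s j` for an undetected cocycle `φ` (file `…FramePartialSpan`); this file
glues them:

* `localTubeSpan_mem_radical_of_relation` — in a relation `Σ_j y_j + Σ_t c_t e_t = 0` (`y_j` in the
  cluster lattice `L_j = ℚe(s j)`, `e_t` node cycles) every `y_j` lies in the radical `L_j ∩ L_j^⊥`.
* `localTubeSpan_H1π_eq_zero_of_multiTail` — given such `v_j`, and JANSSEN COMPANIONS `a, a + cℓ`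
  (transvections in `⟨s j⟩`) for every non-zero radical vector `ℓ` of every cluster (W. Janssen,
  Math. Ann. 266 (1983) Thm. 2.9: `δ + 2β ∈ Δ`), the undetected `φ` is a coboundary: the functional
  `Σ y_j + Σ c_t e_t ↦ Σ_j B(v_j, y_j) - Σ c_t a_t` (`φ(t) = a_t e_t` on nodes) is well defined —
  for a relation, the normal-crossing lemma on the finite orthogonal family
  `{a_j, a_j + c_j y_j}_j ∪ {e_t}` yields `x_H` with `B(v_j, y_j) = B(x_H, y_j)`, `a_t = -B(x_H, e_t)`,
  so the value is `B(x_H, Σ y_j + Σ c_t e_t) = 0` —, equals `B(x, ·)` by nondegeneracy, and `φ = dx` on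
  every generator.

Reference for the setting: C. Schnell, *Primitive cohomology and the tube mapping*, Math. Z. 268
(2010) §7.  No named facts (the companions are a hypothesis).
-/

-- `Summit.HodgeConjecture.HodgeConjecture.Theorems` is the mandated namespace (single-conjunct summit:
-- Sub = Summit), which `linter.dupNamespace` flags on every declaration; the lakefile turns the
-- linter off tree-wide (weak option), restated here so stand-alone elaboration is warning-free too.
set_option linter.dupNamespace false

noncomputable section

open CategoryTheory groupCohomology
open Literature.AlgebraicGeometry.HodgeTheory

namespace Summit.HodgeConjecture.HodgeConjecture.Theorems

section MultiTail

variable {G : Type} [Group G] (A : Rep.{0} ℚ G)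

/-- The NC lemma on a finite commuting sub-configuration, indexed by an arbitrary finite type
(from the `Fin`-indexed `localTubeSpan_exists_sub_eq_of_orthogonal_family`). [folklore] -/
theorem localTubeSpan_exists_sub_eq_of_orthogonal_family' [FiniteDimensional ℚ A.V]
    (B : LinearMap.BilinForm ℚ A.V) (hB : B.Nondegenerate) {ι : Type} [Fintype ι] (g : ι → G)
    (d : ι → A.V) (hd : ∀ i, d i ≠ 0)
    (hPL : ∀ (i : ι) (x : A.V), A.ρ (g i) x = x - B x (d i) • d i)
    (horth : ∀ i j, B (d i) (d j) = 0)
    (φ : cocycles₁ A) (hφ : ∀ g : G, (φ : G → A.V) g ∈ subOneRange A g) :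
    ∃ x : A.V, ∀ i, (φ : G → A.V) (g i) = A.ρ (g i) x - x := by
  classical
  let ε := Fintype.equivFin ι
  obtain ⟨x, hx⟩ := localTubeSpan_exists_sub_eq_of_orthogonal_family A B hB (g ∘ ε.symm)
    (d ∘ ε.symm) (fun i => hd _) (fun i x => hPL _ x) (fun i j => horth _ _) φ hφ
  exact ⟨x, fun i => by simpa using hx (ε i)⟩

variable [FiniteDimensional ℚ A.V] (B : LinearMap.BilinForm ℚ A.V) {b : ℕ} (s : Fin b → Set G)
  (s₀ : Set G) (e : G → A.V)

omit [FiniteDimensional ℚ A.V] in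
/-- **Relations between orthogonal clusters live in the radicals.**  If the clusters' lattices
`L_j = ℚe(s j)` are pairwise orthogonal and the node cycles are orthogonal to everything, then in a
relation `Σ_j y_j + Σ_t c_t e_t = 0` with `y_j ∈ L_j` every `y_j` lies in `L_j ∩ L_j^⊥`. [folklore] -/
theorem localTubeSpan_mem_radical_of_relation (hBalt : B.IsAlt)
    (horth : ∀ i j, i ≠ j → ∀ t ∈ s i, ∀ t' ∈ s j, B (e t) (e t') = 0)
    (horth₀ : ∀ t ∈ s₀, ∀ (j : Fin b), ∀ t' ∈ s j, B (e t) (e t') = 0)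
    (y : Fin b → A.V) (hy : ∀ j, y j ∈ Submodule.span ℚ (e '' s j)) (c : ↥s₀ →₀ ℚ)
    (hrel : ∑ j, y j + c.sum (fun t q => q • e t) = 0) (i : Fin b) :
    y i ∈ Submodule.span ℚ (e '' s i) ⊓ B.orthogonal (Submodule.span ℚ (e '' s i)) := by
  classical
  refine ⟨hy i, LinearMap.BilinForm.mem_orthogonal_iff.2 fun z hz => ?_⟩
  -- `B z ·` kills the other clusters and the nodes, hence `B z (y i) = -B z (rest) = 0`
  have hkill : ∀ w, (w ∈ Submodule.span ℚ (e '' s₀) ∨ ∃ j, j ≠ i ∧ w ∈ Submodule.span ℚ (e '' s j)) →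
      B z w = 0 := by
    -- first for `z` a generator cycle of cluster `i`, then by span induction on `z`
    intro w hw
    have hgen : ∀ z' ∈ e '' s i, B z' w = 0 := by
      rintro _ ⟨t', ht', rfl⟩
      rcases hw with hw | ⟨j, hji, hw⟩
      · refine Submodule.span_induction (fun x hx => ?_) (by simp) (fun x y _ _ hx hy => ?_)
          (fun q x _ hx => ?_) hw
        · obtain ⟨t, ht, rfl⟩ := hx
          rw [← hBalt.neg_eq, horth₀ t ht i t' ht', neg_zero]
        · rw [map_add, hx, hy, add_zero]
        · rw [map_smul, hx, smul_zero]
      · refine Submodule.span_induction (fun x hx => ?_) (by simp) (fun x y _ _ hx hy => ?_)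
          (fun q x _ hx => ?_) hw
        · obtain ⟨t, ht, rfl⟩ := hx
          exact horth i j (Ne.symm hji) t' ht' t ht
        · rw [map_add, hx, hy, add_zero]
        · rw [map_smul, hx, smul_zero]
    refine Submodule.span_induction hgen (by simp) (fun x y _ _ hx hy => ?_) (fun q x _ hx => ?_) hz
    · rw [map_add, LinearMap.add_apply, hx, hy, add_zero]
    · rw [map_smul, LinearMap.smul_apply, hx, smul_zero]
  have h0 : B z (∑ j, y j + c.sum (fun t q => q • e t)) = 0 := by rw [hrel, map_zero]
  rw [map_add, map_sum, Finset.sum_eq_single i (fun j _ hji => hkill _ (Or.inr ⟨j, hji, hy j⟩))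
    (fun h => absurd (Finset.mem_univ i) h)] at h0
  have h1 : B z (c.sum (fun t q => q • e t)) = 0 := by
    refine hkill _ (Or.inl (Submodule.sum_mem _ fun t _ => Submodule.smul_mem _ _ ?_))
    exact Submodule.subset_span ⟨t, t.2, rfl⟩
  rwa [h1, add_zero] at h0

/-- **The tail at a multi-branch point** (first half of `stub_multiCluster`).  Clusters `s j`
(`j : Fin b`) with pairwise orthogonal cycles, nodes `s₀` with non-zero cycles orthogonal to
everything, all acting as transvections of the nondegenerate alternating `B`; an undetected cocycle
`φ` which is a coboundary `dv_j` on each `s j`; Janssen companions in `⟨s j⟩` for every non-zero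
radical vector of every cluster.  Then `φ` is a coboundary. [cite: Schnell2010, §7 Prop. 12 (proof)] -/
theorem localTubeSpan_H1π_eq_zero_of_multiTail (hB : B.Nondegenerate) (hBalt : B.IsAlt)
    (hs : Subgroup.closure (s₀ ∪ ⋃ j, s j) = ⊤)
    (hPL : ∀ t ∈ s₀ ∪ ⋃ j, s j, ∀ x : A.V, A.ρ t x = x - B x (e t) • e t)
    (horth : ∀ i j, i ≠ j → ∀ t ∈ s i, ∀ t' ∈ s j, B (e t) (e t') = 0)
    (horth₀ : ∀ t ∈ s₀, ∀ t' ∈ s₀ ∪ ⋃ j, s j, B (e t) (e t') = 0) (hne₀ : ∀ t ∈ s₀, e t ≠ 0)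
    (hcomp : ∀ (j : Fin b), ∀ ℓ ∈ Submodule.span ℚ (e '' s j) ⊓ B.orthogonal (Submodule.span ℚ (e '' s j)),
      ℓ ≠ 0 → ∃ g₁ ∈ Subgroup.closure (s j), ∃ g₂ ∈ Subgroup.closure (s j), ∃ (a : A.V) (c : ℚ),
        a ≠ 0 ∧ a + c • ℓ ≠ 0 ∧ c ≠ 0 ∧ a ∈ Submodule.span ℚ (e '' s j) ∧
        (∀ x : A.V, A.ρ g₁ x = x - B x a • a) ∧
        (∀ x : A.V, A.ρ g₂ x = x - B x (a + c • ℓ) • (a + c • ℓ)))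
    (φ : cocycles₁ A) (hφ : ∀ g : G, (φ : G → A.V) g ∈ subOneRange A g)
    (v : Fin b → A.V) (hv : ∀ (j : Fin b), ∀ t ∈ s j, (φ : G → A.V) t = A.ρ t (v j) - v j) :
    H1π A φ = 0 := by
  classical
  -- notation
  set L : Fin b → Submodule ℚ A.V := fun j => Submodule.span ℚ (e '' s j) with hL
  have hanti : ∀ x y : A.V, B x y = -B y x := fun x y => (hBalt.neg_eq y x).symm
  have horth₀' : ∀ t ∈ s₀, ∀ (j : Fin b), ∀ t' ∈ s j, B (e t) (e t') = 0 := fun t ht j t' ht' =>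
    horth₀ t ht t' (Or.inr (Set.mem_iUnion.2 ⟨j, ht'⟩))
  -- `φ = d(v j)` on all of `⟨s j⟩`
  have hvcl : ∀ (j : Fin b), ∀ g ∈ Subgroup.closure (s j),
      (φ : G → A.V) g = A.ρ g (v j) - v j := by
    intro j g hg
    obtain ⟨ψ, hψ⟩ : ∃ ψ : cocycles₁ A, ∀ g, (ψ : G → A.V) g = (φ : G → A.V) g - (A.ρ g (v j) - v j) :=
      ⟨φ - ⟨d₀₁ A (v j), d₀₁_apply_mem_cocycles₁ (v j)⟩, fun g => by
        change (φ : G → A.V) g - d₀₁ A (v j) g = _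
        rw [d₀₁_hom_apply]⟩
    have := localTubeSpan_cocycles₁_apply_eq_zero_of_mem_closure A ψ (s j)
      (fun t ht => by rw [hψ, hv j t ht, sub_self]) hg
    rwa [hψ, sub_eq_zero] at this
  -- node values `φ(t) = a_t e_t`
  have hex : ∀ t ∈ s₀, ∃ q : ℚ, (φ : G → A.V) t = q • e t := fun t ht => by
    obtain ⟨w, hw⟩ := hφ t
    refine ⟨-B w (e t), ?_⟩
    rw [← hw, LinearMap.sub_apply, LinearMap.id_apply, hPL t (Or.inl ht), neg_smul]
    abel
  choose! a ha using hex
  -- orthogonality bookkeeping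
  have hB_node_L : ∀ t ∈ s₀, ∀ (j : Fin b), ∀ y ∈ L j, B (e t) y = 0 ∧ B y (e t) = 0 := by
    intro t ht j y hy
    have h1 : B (e t) y = 0 := by
      refine Submodule.span_induction (fun x hx => ?_) (by simp) (fun x y _ _ hx hy => ?_)
        (fun q x _ hx => ?_) hy
      · obtain ⟨t', ht', rfl⟩ := hx
        exact horth₀' t ht j t' ht'
      · rw [map_add, hx, hy, add_zero]
      · rw [map_smul, hx, smul_zero]
    exact ⟨h1, by rw [hanti, h1, neg_zero]⟩
  have hB_node_node : ∀ t ∈ s₀, ∀ t' ∈ s₀, B (e t) (e t') = 0 := fun t ht t' ht' =>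
    horth₀ t ht t' (Or.inl ht')
  have hB_L_L : ∀ (i j : Fin b), i ≠ j → ∀ x ∈ L i, ∀ y ∈ L j, B x y = 0 := by
    intro i j hij x hx y hy
    have hgen : ∀ x' ∈ e '' s i, B x' y = 0 := by
      rintro _ ⟨t, ht, rfl⟩
      refine Submodule.span_induction (fun z hz => ?_) (by simp) (fun z w _ _ hz hw => ?_)
        (fun q z _ hz => ?_) hy
      · obtain ⟨t', ht', rfl⟩ := hz
        exact horth i j hij t ht t' ht'
      · rw [map_add, hz, hw, add_zero]
      · rw [map_smul, hz, smul_zero]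
    refine Submodule.span_induction hgen (by simp) (fun z w _ _ hz hw => ?_) (fun q z _ hz => ?_) hx
    · rw [map_add, LinearMap.add_apply, hz, hw, add_zero]
    · rw [map_smul, LinearMap.smul_apply, hz, smul_zero]
  -- Step 1: consistency of the would-be functional on relations
  have hcons : ∀ (y : Fin b → A.V), (∀ j, y j ∈ L j) → ∀ (c : ↥s₀ →₀ ℚ),
      ∑ j, y j + c.sum (fun t q => q • e t) = 0 →
      ∑ j, B (v j) (y j) - c.sum (fun t q => q * a t) = 0 := by
    intro y hy c hrel
    have hyR : ∀ j, y j ∈ L j ⊓ B.orthogonal (L j) := fun j =>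
      localTubeSpan_mem_radical_of_relation A B s s₀ e hBalt horth horth₀' y hy c hrel j
    -- companions for the clusters with `y j ≠ 0`
    have hcomp' : ∀ j : {j : Fin b // y j ≠ 0}, ∃ g₁ ∈ Subgroup.closure (s j), ∃ g₂ ∈ Subgroup.closure (s j),
        ∃ (a₀ : A.V) (c₀ : ℚ), a₀ ≠ 0 ∧ a₀ + c₀ • y j ≠ 0 ∧ c₀ ≠ 0 ∧ a₀ ∈ L j ∧
        (∀ x : A.V, A.ρ g₁ x = x - B x a₀ • a₀) ∧
        (∀ x : A.V, A.ρ g₂ x = x - B x (a₀ + c₀ • y j) • (a₀ + c₀ • y j)) := fun j =>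
      hcomp j (y j) (hyR j) j.2
    choose g₁ hg₁ g₂ hg₂ a₀ c₀ ha₀ ha₀y hc₀ ha₀L hg₁T hg₂T using hcomp'
    -- the finite orthogonal family: companions for the `j` with `y j ≠ 0`, and the nodes in the support
    let ι := ({j : Fin b // y j ≠ 0} × Bool) ⊕ {t : ↥s₀ // t ∈ c.support}
    let gfam : ι → G := fun k => match k with
      | Sum.inl (j, false) => g₁ j
      | Sum.inl (j, true) => g₂ j
      | Sum.inr t => (t : G)
    let dfam : ι → A.V := fun k => match k with
      | Sum.inl (j, false) => a₀ j
      | Sum.inl (j, true) => a₀ j + c₀ j • y j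
      | Sum.inr t => e (t : G)
    have hdfam : ∀ k, dfam k ≠ 0 := by
      rintro ((⟨j, _ | _⟩) | t)
      · exact ha₀ j
      · exact ha₀y j
      · exact hne₀ _ t.1.2
    have hPLfam : ∀ (k : ι) (x : A.V), A.ρ (gfam k) x = x - B x (dfam k) • dfam k := by
      rintro ((⟨j, _ | _⟩) | t) x
      · exact hg₁T j x
      · exact hg₂T j x
      · exact hPL _ (Or.inl t.1.2) x
    -- pairwise orthogonality of the family
    have hyL : ∀ j : {j : Fin b // y j ≠ 0}, y j ∈ L j := fun j => (hyR j).1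
    have hcl : ∀ (j : {j : Fin b // y j ≠ 0}) (bb : Bool),
        dfam (Sum.inl (j, bb)) ∈ L j := by
      rintro j (_ | _)
      · exact ha₀L j
      · exact (L j).add_mem (ha₀L j) ((L j).smul_mem _ (hyL j))
    have hsame : ∀ (j : {j : Fin b // y j ≠ 0}) (bb bb' : Bool),
        B (dfam (Sum.inl (j, bb))) (dfam (Sum.inl (j, bb'))) = 0 := by
      -- inside one cluster: `B a a = 0`, `B a y = 0 = B y a` (radical), so all four vanish
      intro j bb bb'
      have hay : B (a₀ j) (y j) = 0 :=
        (LinearMap.BilinForm.mem_orthogonal_iff.1 (hyR j).2) _ (ha₀L j)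
      have hya : B (y j) (a₀ j) = 0 := by rw [hanti, hay, neg_zero]
      have haa : B (a₀ j) (a₀ j) = 0 := hBalt _
      have hyy : B (y j) (y j) = 0 := hBalt _
      rcases bb with _ | _ <;> rcases bb' with _ | _ <;>
        simp [dfam, haa, hay, hya, hyy]
    have horthfam : ∀ k k', B (dfam k) (dfam k') = 0 := by
      rintro ((⟨j, bb⟩) | t) ((⟨j', bb'⟩) | t')
      · by_cases hjj : (j : Fin b) = j'
        · have : j = j' := Subtype.ext hjj
          subst this
          exact hsame j bb bb'
        · exact hB_L_L j j' hjj _ (hcl j bb) _ (hcl j' bb')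
      · exact (hB_node_L _ t'.1.2 j _ (hcl j bb)).2
      · exact (hB_node_L _ t.1.2 j' _ (hcl j' bb')).1
      · exact hB_node_node _ t.1.2 _ t'.1.2
    obtain ⟨xH, hxH⟩ := localTubeSpan_exists_sub_eq_of_orthogonal_family' A B hB gfam dfam hdfam
      hPLfam horthfam φ hφ
    -- read off `B(v j, y j) = B(x_H, y j)` for every `j`
    have hvy : ∀ j : Fin b, B (v j) (y j) = B xH (y j) := by
      intro j
      by_cases hyj : y j = 0
      · rw [hyj, map_zero, map_zero]
      · let jj : {j : Fin b // y j ≠ 0} := ⟨j, hyj⟩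
        have h1 := hxH (Sum.inl (jj, false))
        have h2 := hxH (Sum.inl (jj, true))
        change (φ : G → A.V) (g₁ jj) = A.ρ (g₁ jj) xH - xH at h1
        change (φ : G → A.V) (g₂ jj) = A.ρ (g₂ jj) xH - xH at h2
        rw [hvcl j _ (hg₁ jj), hg₁T, hg₁T, sub_sub_cancel_left, sub_sub_cancel_left, neg_inj] at h1
        rw [hvcl j _ (hg₂ jj), hg₂T, hg₂T, sub_sub_cancel_left, sub_sub_cancel_left, neg_inj] at h2
        have e1 : B (v j) (a₀ jj) = B xH (a₀ jj) := by
          have := sub_eq_zero.2 h1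
          rw [← sub_smul, smul_eq_zero] at this
          exact sub_eq_zero.1 (this.resolve_right (ha₀ jj))
        have e2 : B (v j) (a₀ jj + c₀ jj • y j) = B xH (a₀ jj + c₀ jj • y j) := by
          have := sub_eq_zero.2 h2
          rw [← sub_smul, smul_eq_zero] at this
          exact sub_eq_zero.1 (this.resolve_right (ha₀y jj))
        rw [map_add, map_add, map_smul, map_smul, e1, add_right_inj, smul_eq_mul, smul_eq_mul] at e2
        exact mul_left_cancel₀ (hc₀ jj) e2
    -- and `a_t = -B(x_H, e_t)` on the support
    have hat : ∀ t ∈ c.support, a t = -B xH (e t) := fun t htc => by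
      have h1 := hxH (Sum.inr ⟨t, htc⟩)
      change (φ : G → A.V) t = A.ρ (t : G) xH - xH at h1
      rw [ha t t.2, hPL t (Or.inl t.2), sub_sub_cancel_left] at h1
      have h2 : (a t + B xH (e t)) • e (t : G) = 0 := by rw [add_smul, h1, neg_add_cancel]
      rcases smul_eq_zero.1 h2 with h3 | h3
      · linarith [h3]
      · exact absurd h3 (hne₀ t t.2)
    -- sum up: the value is `B(x_H, relation) = 0`
    have e1 : ∑ j, B (v j) (y j) = B xH (∑ j, y j) := by
      rw [map_sum]; exact Finset.sum_congr rfl fun j _ => hvy j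
    have e2 : c.sum (fun t q => q * a t) = -B xH (c.sum (fun t q => q • e t)) := by
      simp only [Finsupp.sum, map_sum, map_smul, smul_eq_mul, ← Finset.sum_neg_distrib]
      refine Finset.sum_congr rfl fun t htc => ?_
      rw [hat t htc]; ring
    rw [e1, e2, sub_neg_eq_add, ← map_add, hrel, map_zero]
  -- Step 2: the functional `F` with `F|L_j = B(v_j, ·)` and `F(e_t) = -a_t`
  obtain ⟨F, hFL, hF₀⟩ : ∃ F : Module.Dual ℚ A.V, (∀ (j : Fin b), ∀ y ∈ L j, F y = B (v j) y) ∧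
      ∀ t ∈ s₀, F (e t) = -a t := by
    let Φ : (((j : Fin b) → ↥(L j)) × (↥s₀ →₀ ℚ)) →ₗ[ℚ] A.V :=
      (∑ j, (L j).subtype ∘ₗ LinearMap.proj j).coprod (Finsupp.linearCombination ℚ fun t : ↥s₀ => e t)
    let Λ : (((j : Fin b) → ↥(L j)) × (↥s₀ →₀ ℚ)) →ₗ[ℚ] ℚ :=
      (∑ j, (B (v j) ∘ₗ (L j).subtype) ∘ₗ LinearMap.proj j).coprod
        (Finsupp.linearCombination ℚ fun t : ↥s₀ => -a t)
    have hΦ : ∀ z, Φ z = ∑ j, (z.1 j : A.V) + z.2.sum (fun t q => q • e t) := fun z => by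
      change (∑ j, (L j).subtype ∘ₗ LinearMap.proj j) z.1 +
        Finsupp.linearCombination ℚ (fun t : ↥s₀ => e t) z.2 = _
      rw [LinearMap.sum_apply, Finsupp.linearCombination_apply]
      rfl
    have hΛ : ∀ z, Λ z = ∑ j, B (v j) (z.1 j) + z.2.sum (fun t q => q * -a t) := fun z => by
      change (∑ j, (B (v j) ∘ₗ (L j).subtype) ∘ₗ LinearMap.proj j) z.1 +
        Finsupp.linearCombination ℚ (fun t : ↥s₀ => -a t) z.2 = _
      rw [LinearMap.sum_apply, Finsupp.linearCombination_apply]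
      rfl
    have hker : LinearMap.ker Φ ≤ LinearMap.ker Λ := by
      intro z hz
      rw [LinearMap.mem_ker] at hz ⊢
      rw [hΦ] at hz
      rw [hΛ]
      have h1 := hcons (fun j => (z.1 j : A.V)) (fun j => (z.1 j).2) z.2 hz
      have e1 : z.2.sum (fun t q => q * -a t) = -z.2.sum (fun t q => q * a t) := by
        simp only [Finsupp.sum, mul_neg, Finset.sum_neg_distrib]
      rw [e1, ← sub_eq_add_neg, h1]
    let f₀ : LinearMap.range Φ →ₗ[ℚ] ℚ :=
      (LinearMap.ker Φ).liftQ Λ hker ∘ₗ (Φ.quotKerEquivRange).symm.toLinearMap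
    have hf₀ : ∀ z, f₀ ⟨Φ z, LinearMap.mem_range_self Φ z⟩ = Λ z := fun z => by
      change (LinearMap.ker Φ).liftQ Λ hker ((Φ.quotKerEquivRange).symm ⟨Φ z, _⟩) = Λ z
      rw [LinearMap.quotKerEquivRange_symm_apply_image Φ z (LinearMap.mem_range_self Φ z)]
      rfl
    refine ⟨Subspace.dualLift (LinearMap.range Φ) f₀, fun j y hy => ?_, fun t ht => ?_⟩
    · have e1 : y = Φ (Pi.single j ⟨y, hy⟩, 0) := by
        rw [hΦ]
        simp only [Finsupp.sum_zero_index, add_zero]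
        rw [Finset.sum_eq_single j (fun i _ hij => by rw [Pi.single_eq_of_ne hij]; rfl)
          (fun h => absurd (Finset.mem_univ j) h), Pi.single_eq_same]
      have hmem : y ∈ LinearMap.range Φ := ⟨_, e1.symm⟩
      rw [Subspace.dualLift_of_mem hmem]
      have : (⟨y, hmem⟩ : LinearMap.range Φ) = ⟨Φ (Pi.single j ⟨y, hy⟩, 0), LinearMap.mem_range_self Φ _⟩ :=
        Subtype.ext e1
      rw [this, hf₀, hΛ]
      simp only [Finsupp.sum_zero_index, add_zero]
      rw [Finset.sum_eq_single j (fun i _ hij => by rw [Pi.single_eq_of_ne hij]; simp)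
        (fun h => absurd (Finset.mem_univ j) h), Pi.single_eq_same]
    · have e1 : e t = Φ (0, Finsupp.single ⟨t, ht⟩ 1) := by
        rw [hΦ]; simp
      have hmem : e t ∈ LinearMap.range Φ := ⟨_, e1.symm⟩
      rw [Subspace.dualLift_of_mem hmem]
      have : (⟨e t, hmem⟩ : LinearMap.range Φ) = ⟨Φ (0, Finsupp.single ⟨t, ht⟩ 1), LinearMap.mem_range_self Φ _⟩ :=
        Subtype.ext e1
      rw [this, hf₀, hΛ]
      simp
  -- Step 3: `F = B(x, ·)`; `dx` agrees with `φ` on every generator; conclude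
  obtain ⟨x, hx⟩ : ∃ x : A.V, ∀ y, B x y = F y :=
    ⟨(B.toDual hB).symm F, fun y => LinearMap.BilinForm.apply_toDual_symm_apply F y⟩
  obtain ⟨ψ, hψapply⟩ : ∃ ψ : cocycles₁ A,
      ∀ g, (ψ : G → A.V) g = (φ : G → A.V) g - (A.ρ g x - x) :=
    ⟨φ - ⟨d₀₁ A x, d₀₁_apply_mem_cocycles₁ x⟩, fun g => by
      change (φ : G → A.V) g - d₀₁ A x g = _
      rw [d₀₁_hom_apply]⟩
  have hgen : ∀ t ∈ s₀ ∪ ⋃ j, s j, (ψ : G → A.V) t = 0 := by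
    rintro t (ht | ht)
    · rw [hψapply, ha t ht, hPL t (Or.inl ht), hx, hF₀ t ht, sub_sub_cancel_left, neg_smul, neg_neg,
        sub_self]
    · obtain ⟨j, htj⟩ := Set.mem_iUnion.1 ht
      have hmem : e t ∈ L j := Submodule.subset_span ⟨t, htj, rfl⟩
      rw [hψapply, hv j t htj, hPL t (Or.inr ht), hPL t (Or.inr ht), hx, hFL j (e t) hmem]
      simp
  have hall : ∀ g, (ψ : G → A.V) g = 0 := fun g =>
    localTubeSpan_cocycles₁_apply_eq_zero_of_mem_closure A ψ _ hgen
      (by rw [hs]; exact Subgroup.mem_top g)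
  rw [H1π_eq_zero_iff, mem_coboundaries₁_iff_exists]
  refine ⟨x, fun g => ?_⟩
  have := hall g
  rw [hψapply, sub_eq_zero] at this
  exact this.symm

end MultiTail

end Summit.HodgeConjecture.HodgeConjecture.Theorems

end
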